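import Literature.AnabelianGeometry.SemiGraphs.ProSigmaCuspMalnormalEngine
import Literature.AnabelianGeometry.SemiGraphs.ProSigmaCompletionInjective
import Literature.AnabelianGeometry.SemiGraphs.ProSigmaBoundaryMalnormalPrelims
import Mathlib.Topology.Instances.ZMod
import Mathlib.Algebra.Group.TypeTags.Finite
import Mathlib.Algebra.Group.Conj
import HarnessLib

/-!
# Malnormality of the boundary cusp in the pro-`Σ` completion of a once-punctured surface group

[SemiAnbd] Example 2.10 (p. 31) / [AbsAnab] Lemma 1.3.7: the closed cusp inertia subgroups of the pro-`Σ`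
completion of a hyperbolic punctured surface group are malnormal — abc-iut-L3-t11's named fact
`ProSigmaCuspInertiaMalnormal` (`SurfaceTypeEstranged.lean`) [cite: MochizukiSemiAnbd2006, Ex. 2.10 p.31].
This file PROVES the case `r = 1` (theorems only): for `Γ = Γ_{g,1}`, `g ≥ 1`, the cusp
`c₁ = ([a₁,b₁]⋯[a_g,b_g])⁻¹` is NOT a free basis element (it is a product of commutators), so the
basis-element lift `c ↦ (δ_pt, c̄)` of the permutation-module engine (`ProSigmaCuspMalnormalEngine.lean`)
does not exist (every lift `Γ_{g,1} → (α →₀ R) ⋊ Q` sends `c₁` into the augmentation submodule).  The way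
out used here: a TWO-POINT translation component `m₀ = δ_pt − δ_{pt₁}` IS realisable — lift `a_i ↦ (0, ā_i)`,
`b_i ↦ (0, b̄_i)` (`i ≥ 2`), `b₁ ↦ (β, b̄₁)`, `c₁ ↦ (m₀, c̄₁)` with `β = −∑_{s<t} γ₀^s δ_{q₀}` — with the far
point `pt₁ = γ^t · pt` on the orbit of a conjugate `γ` of `ā₁⁻¹`; and `pt₁` can be chosen OUTSIDE the finite
exceptional set `{pt} ∪ {c̄^i x̄⁻¹ pt}` of the engine once the level `N` is deepened by the kernel of the
character `a₁ ↦ 1 ∈ ℤ/p^k` (which kills `c₁`, so the powers of `c̄` are unchanged while the points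
`γ^t pt`, `t < p^k`, become pairwise distinct) — pigeonhole.  Hence every `y ∈ I ∩ x I x⁻¹`, `x ∉ I`,
dies in every open normal subgroup, i.e. `I ∩ x I x⁻¹ = 1`.

Main result: `cuspInertia_closure_inf_conj_eq_bot_of_one` — the clause of `ProSigmaCuspInertiaMalnormal`
for `r = 1` verbatim (both cusp indices range over `Fin 1`).  Plain (pro)finite group theory; nothing here
bears on [IUTchIII] Cor. 3.12.
-/


namespace Literature.AnabelianGeometry.SemiGraphs.SemiGraphOfAnabelioids

open Literature.AnabelianGeometry.Anabelioids Literature.GroupTheory.CombinatorialGroupTheory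
open Multiplicative
open scoped Pointwise

/-! ### The case `r = 1` -/

/-- **Malnormality of the boundary cusp (`r = 1`).**  For a nonempty set of primes `Σ`, a hyperbolic
type `(g, 1)` (i.e. `g ≥ 1`), a pro-`Σ` completion `ι : Γ_{g,1} → P` (`P` profinite) and the closed
cusp inertia `I = closure ι⟨c₁⟩`: `I ∩ x I x⁻¹ = 1` for every `x ∉ I` — the clause of
`ProSigmaCuspInertiaMalnormal` for `r = 1`, in its printed shape (indices `i j : Fin 1`, hypothesis
`i ≠ j ∨ x ∉ I_i`).  Proof: permutation-module engine with the two-point translation component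
described in the module docstring. [cite: MochizukiSemiAnbd2006, Ex. 2.10 p.31] -/
theorem cuspInertia_closure_inf_conj_eq_bot_of_one {Sigma : Set ℕ} (hS : Sigma.Nonempty)
    (hS' : ∀ p ∈ Sigma, p.Prime) {g : ℕ} (hg : PuncturedSurfaceGroup.IsHyperbolicType g 1)
    {P : Type*} [Group P] [TopologicalSpace P] [IsTopologicalGroup P] [CompactSpace P] [T2Space P]
    [TotallyDisconnectedSpace P] (ι : PuncturedSurfaceGroup g 1 →* P)
    (hι : IsProSigmaCompletion Sigma ι) (i j : Fin 1) (x : P)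
    (hx : i ≠ j ∨ x ∉ ((PuncturedSurfaceGroup.cuspInertia (g := g) i).map ι).topologicalClosure) :
    ((PuncturedSurfaceGroup.cuspInertia (g := g) i).map ι).topologicalClosure ⊓
        ConjAct.toConjAct x •
          ((PuncturedSurfaceGroup.cuspInertia (g := g) j).map ι).topologicalClosure = ⊥ := by
  classical
  have hi : i = 0 := Fin.eq_zero i
  have hj : j = 0 := Fin.eq_zero j
  subst hi hj
  have hxI : x ∉ ((PuncturedSurfaceGroup.cuspInertia (g := g) (0 : Fin 1)).map ι).topologicalClosure := by
    rcases hx with h | h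
    · exact absurd rfl h
    · exact h
  simp only [PuncturedSurfaceGroup.cuspInertia] at hxI ⊢
  -- `g = g' + 1`
  obtain ⟨g', rfl⟩ : ∃ g', g = g' + 1 :=
    ⟨g - 1, by unfold PuncturedSurfaceGroup.IsHyperbolicType at hg; omega⟩
  rw [eq_bot_iff]
  rintro y ⟨hyI, hyJ⟩
  rw [Subgroup.mem_bot]
  refine eq_one_of_forall_mem_openNormalSubgroup fun N₀ => ?_
  -- a level below which `x ∉ I · N`
  obtain ⟨N₁, hN₁⟩ :=
    exists_openNormalSubgroup_not_mem_mul (Subgroup.isClosed_topologicalClosure _) hxI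
  -- a prime of `Σ`
  obtain ⟨p, hpS⟩ := hS
  have hp : p.Prime := hS' p hpS
  -- the exponent `e = [P : N₀ ∩ N₁]` and the deepening character `a₁ ↦ 1 ∈ ℤ/p^(e+1)`
  obtain ⟨e, he⟩ : ∃ e, e = ((N₀ ⊓ N₁ : OpenNormalSubgroup P) : Subgroup P).index := ⟨_, rfl⟩
  haveI : NeZero (p ^ (e + 1)) := ⟨(pow_pos hp.pos _).ne'⟩
  obtain ⟨χ, hχa, hχc⟩ :=
    PuncturedSurfaceGroup.exists_aCharacter (g := g' + 1) (r := 1) 0 (p ^ (e + 1))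
  have hcard : IsSigmaInteger Sigma (Nat.card (Multiplicative (ZMod (p ^ (e + 1))))) := by
    rw [Nat.card_congr Multiplicative.toAdd, Nat.card_zmod]
    exact IsProSigmaCompletion.isSigmaInteger_prime_pow hp hpS (e + 1)
  obtain ⟨χh, hχhc, hχh⟩ := hι.exists_continuous_extend_top hcard χ
  have hKo : IsOpen (χh.ker : Set P) := (isOpen_discrete ({1} : Set _)).preimage hχhc
  let K : OpenNormalSubgroup P := { toSubgroup := χh.ker, isOpen' := hKo }
  let N : OpenNormalSubgroup P := N₀ ⊓ N₁ ⊓ K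
  have hNle₀ : (N : Subgroup P) ≤ (N₀ : Subgroup P) := fun z hz => hz.1.1
  have hNle₂ : (N : Subgroup P) ≤ ((N₀ ⊓ N₁ : OpenNormalSubgroup P) : Subgroup P) := fun z hz => hz.1
  have hNleK : (N : Subgroup P) ≤ χh.ker := fun z hz => hz.2
  have hN₁' : ∀ z ∈ ((Subgroup.zpowers (PuncturedSurfaceGroup.c (0 : Fin 1))).map ι).topologicalClosure,
      ∀ n ∈ (N : Subgroup P), z * n ≠ x :=
    hN₁ N (inf_le_left.trans inf_le_right)
  haveI : (N : Subgroup P).Normal := N.isNormal'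
  haveI : Finite (P ⧸ (N : Subgroup P)) := finite_quotient_openNormalSubgroup N
  apply hNle₀
  -- the quotient `Q = P/N` and its elements
  let mk : P →* P ⧸ (N : Subgroup P) := QuotientGroup.mk' (N : Subgroup P)
  let θ : PuncturedSurfaceGroup (g' + 1) 1 →* P ⧸ (N : Subgroup P) := mk.comp ι
  obtain ⟨cq, hcq⟩ : ∃ cq, cq = θ (PuncturedSurfaceGroup.c 0) := ⟨_, rfl⟩
  obtain ⟨aq, haq⟩ : ∃ aq, aq = θ (PuncturedSurfaceGroup.a 0) := ⟨_, rfl⟩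
  obtain ⟨bq, hbq⟩ : ∃ bq, bq = θ (PuncturedSurfaceGroup.b 0) := ⟨_, rfl⟩
  obtain ⟨xq, hxq⟩ : ∃ xq, xq = mk x := ⟨_, rfl⟩
  obtain ⟨κ, hκ⟩ : ∃ κ, κ = aq * bq * aq⁻¹ * bq⁻¹ := ⟨_, rfl⟩
  obtain ⟨ρ, hρ⟩ : ∃ ρ, ρ = ((List.finRange g').map fun i =>
      θ (PuncturedSurfaceGroup.a i.succ) * θ (PuncturedSurfaceGroup.b i.succ) *
        (θ (PuncturedSurfaceGroup.a i.succ))⁻¹ * (θ (PuncturedSurfaceGroup.b i.succ))⁻¹).prod :=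
    ⟨_, rfl⟩
  -- the relation `κ ρ c̄ = 1`
  have hrel : κ * ρ * cq = 1 := by
    rw [hκ, hρ, hcq, haq, hbq]
    exact PuncturedSurfaceGroup.relation_map_one θ
  have hκρ : κ * ρ = cq⁻¹ := eq_inv_of_mul_eq_one_left hrel
  -- the character on `Q`
  let χQ : P ⧸ (N : Subgroup P) →* Multiplicative (ZMod (p ^ (e + 1))) :=
    QuotientGroup.lift (N : Subgroup P) χh hNleK
  have hχQ : ∀ z, χQ (mk z) = χh z := fun z => QuotientGroup.lift_mk' _ hNleK z
  have hχQc : χQ cq = 1 := by rw [hcq]; change χQ (mk _) = 1; rw [hχQ, hχh, hχc]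
  have hχQa : χQ aq = ofAdd 1 := by rw [haq]; change χQ (mk _) = _; rw [hχQ, hχh, hχa]
  have hχQκ : χQ κ = 1 := by
    rw [hκ, map_mul, map_mul, map_mul, map_inv, map_inv, mul_inv_eq_one, mul_inv_eq_iff_eq_mul,
      mul_comm]
  -- `γ₀ = κ⁻¹ ā`, `u = c̄ κ`, `γ = u γ₀⁻¹ u⁻¹` (a conjugate of `ā⁻¹`)
  obtain ⟨γ₀, hγ₀⟩ : ∃ γ₀, γ₀ = κ⁻¹ * aq := ⟨_, rfl⟩
  obtain ⟨u, hu⟩ : ∃ u, u = cq * κ := ⟨_, rfl⟩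
  obtain ⟨γ, hγ⟩ : ∃ γ, γ = u * γ₀⁻¹ * u⁻¹ := ⟨_, rfl⟩
  have hχQγ : χQ γ = (ofAdd 1)⁻¹ := by
    rw [hγ, map_mul, map_mul, map_inv, map_inv, hγ₀, map_mul, map_inv, hχQκ, hχQa, inv_one, one_mul,
      mul_inv_eq_iff_eq_mul, mul_comm]
  -- the cyclic subgroup `C = ⟨c̄⟩`, the coset space `α = Q/C`, the base point
  obtain ⟨C, hC⟩ : ∃ C : Subgroup (P ⧸ (N : Subgroup P)), C = Subgroup.zpowers cq := ⟨_, rfl⟩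
  haveI : Finite ((P ⧸ (N : Subgroup P)) ⧸ C) := Finite.of_surjective _ QuotientGroup.mk_surjective
  -- the permutation module `(Q/C →₀ ZMod |Q|)` with the translation action (Mathlib's non-instance defs)
  letI : SMul (P ⧸ (N : Subgroup P))
      (((P ⧸ (N : Subgroup P)) ⧸ C) →₀ ZMod (Nat.card (P ⧸ (N : Subgroup P)))) := Finsupp.comapSMul
  letI : MulAction (P ⧸ (N : Subgroup P))
      (((P ⧸ (N : Subgroup P)) ⧸ C) →₀ ZMod (Nat.card (P ⧸ (N : Subgroup P)))) := Finsupp.comapMulAction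
  letI : DistribMulAction (P ⧸ (N : Subgroup P))
      (((P ⧸ (N : Subgroup P)) ⧸ C) →₀ ZMod (Nat.card (P ⧸ (N : Subgroup P)))) :=
    Finsupp.comapDistribMulAction
  obtain ⟨pt, hpt⟩ : ∃ pt : (P ⧸ (N : Subgroup P)) ⧸ C, pt = ((1 : P ⧸ (N : Subgroup P)) : _ ⧸ C) :=
    ⟨_, rfl⟩
  have hsmul_pt : ∀ q : P ⧸ (N : Subgroup P), q • pt = (q : (P ⧸ (N : Subgroup P)) ⧸ C) := fun q => by
    rw [hpt, MulAction.Quotient.smul_coe, smul_eq_mul, mul_one]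
  have hpt_eq : ∀ q q' : P ⧸ (N : Subgroup P), q • pt = q' • pt ↔ q⁻¹ * q' ∈ C := fun q q' => by
    rw [hsmul_pt, hsmul_pt, QuotientGroup.eq]
  have hχQC : ∀ z ∈ C, χQ z = 1 := by
    rw [hC]
    rintro _ ⟨k, rfl⟩
    rw [map_zpow, hχQc, one_zpow]
  have hcpt : cq • pt = pt := by
    conv_rhs => rw [← one_smul (P ⧸ (N : Subgroup P)) pt]
    rw [hpt_eq, hC, mul_one]
    exact Subgroup.inv_mem _ (Subgroup.mem_zpowers _)
  -- `x̄ ∉ C`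
  have hxC : xq ∉ C := by
    rw [hxq, hC, hcq]
    exact mk_not_mem_zpowers_of_forall_mul_ne (N : Subgroup P)
      (Subgroup.le_topologicalClosure _ (Subgroup.mem_map_of_mem ι (Subgroup.mem_zpowers _))) hN₁'
  -- `c̄ ^ e = 1`
  have hce : cq ^ e = 1 := by
    rw [hcq]
    change mk (ι (PuncturedSurfaceGroup.c 0)) ^ e = 1
    rw [← map_pow, QuotientGroup.mk'_apply, QuotientGroup.eq_one_iff]
    refine ⟨?_, ?_⟩
    · rw [he]
      exact Subgroup.pow_index_mem _ _
    · change χh (ι (PuncturedSurfaceGroup.c 0) ^ e) = 1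
      rw [map_pow, hχh, hχc, one_pow]
  have he0 : 0 < e := by
    rw [he]
    exact (hι.index_open _ (N₀ ⊓ N₁ : OpenNormalSubgroup P).isNormal'
      (N₀ ⊓ N₁ : OpenNormalSubgroup P).isOpen').1
  -- the exceptional set `B = {pt} ∪ {c̄^i x̄⁻¹ pt : i < e}` and its bound
  obtain ⟨B, hB⟩ : ∃ B : Finset ((P ⧸ (N : Subgroup P)) ⧸ C),
      B = insert pt ((Finset.range e).image fun i => (cq ^ i * xq⁻¹) • pt) := ⟨_, rfl⟩
  have hBcard : B.card ≤ e + 1 := by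
    rw [hB]
    refine (Finset.card_insert_le _ _).trans ?_
    simpa using Finset.card_image_le (s := Finset.range e) (f := fun i => (cq ^ i * xq⁻¹) • pt)
  have hBmem : ∀ i : ℤ, (cq ^ i * xq⁻¹) • pt ∈ B := by
    intro i
    rw [hB, Finset.mem_insert]
    refine Or.inr (Finset.mem_image.mpr ⟨(i % (e : ℤ)).toNat, ?_, ?_⟩)
    · rw [Finset.mem_range]
      have h1 := Int.emod_lt_of_pos i (show (0 : ℤ) < e by exact_mod_cast he0)
      have h2 := Int.emod_nonneg i (show (e : ℤ) ≠ 0 by exact_mod_cast he0.ne')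
      omega
    · have hpow : cq ^ (i % (e : ℤ)).toNat = cq ^ i := by
        rw [← zpow_natCast, Int.toNat_of_nonneg (Int.emod_nonneg i (by exact_mod_cast he0.ne'))]
        conv_rhs => rw [← Int.emod_add_mul_ediv i (e : ℤ), zpow_add, zpow_mul, zpow_natCast, hce,
          one_zpow, mul_one]
      rw [hpow]
  have hptB : pt ∈ B := by rw [hB]; exact Finset.mem_insert_self _ _
  -- the points `γ^t pt`, `t < p^(e+1)`, are pairwise distinct
  have hinj : Set.InjOn (fun t : ℕ => γ ^ t • pt) (Finset.range (p ^ (e + 1)) : Set ℕ) := by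
    intro t ht s hs hts
    simp only [Finset.coe_range, Set.mem_Iio] at ht hs
    have hts' : γ ^ t • pt = γ ^ s • pt := hts
    have hmem : (γ ^ t)⁻¹ * γ ^ s ∈ C := (hpt_eq _ _).mp hts'
    have h1 := hχQC _ hmem
    rw [map_mul, map_inv, map_pow, map_pow, hχQγ, inv_pow, inv_inv, inv_pow, ← zpow_natCast,
      ← zpow_natCast, ← zpow_neg, ← zpow_add, ← ofAdd_zsmul, ofAdd_eq_one, zsmul_one,
      Int.cast_add, Int.cast_neg, Int.cast_natCast, Int.cast_natCast, add_neg_eq_zero,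
      ZMod.natCast_eq_natCast_iff', Nat.mod_eq_of_lt ht, Nat.mod_eq_of_lt hs] at h1
    exact h1
  -- pigeonhole: some `γ^t pt` lies outside `B`
  obtain ⟨t, -, htB⟩ : ∃ t ∈ Finset.range (p ^ (e + 1)), γ ^ t • pt ∉ B := by
    by_contra hall
    push Not at hall
    have hsub : (Finset.range (p ^ (e + 1))).image (fun t => γ ^ t • pt) ⊆ B := by
      intro q hq
      obtain ⟨t, ht, rfl⟩ := Finset.mem_image.mp hq
      exact hall t ht
    have h1 := (Finset.card_le_card hsub).trans hBcard
    rw [Finset.card_image_of_injOn hinj, Finset.card_range] at h1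
    have h2 : e + 1 < 2 ^ (e + 1) := Nat.lt_two_pow_self
    have h3 : 2 ^ (e + 1) ≤ p ^ (e + 1) := Nat.pow_le_pow_left hp.two_le _
    omega
  -- the far point, the translation components `m₀` and `β`
  obtain ⟨pt₁, hpt₁⟩ : ∃ pt₁, pt₁ = γ ^ t • pt := ⟨_, rfl⟩
  rw [← hpt₁] at htB
  have hpt₁ne : pt₁ ≠ pt := fun h => htB (h ▸ hptB)
  obtain ⟨m₀, hm₀⟩ : ∃ m₀ : ((P ⧸ (N : Subgroup P)) ⧸ C) →₀ ZMod (Nat.card (P ⧸ (N : Subgroup P))),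
      m₀ = Finsupp.single pt 1 - Finsupp.single pt₁ 1 := ⟨_, rfl⟩
  obtain ⟨q₀, hq₀⟩ : ∃ q₀, q₀ = (κ⁻¹ * cq⁻¹) • pt₁ := ⟨_, rfl⟩
  obtain ⟨S, hSdef⟩ : ∃ S : ((P ⧸ (N : Subgroup P)) ⧸ C) →₀ ZMod (Nat.card (P ⧸ (N : Subgroup P))),
      S = ∑ s ∈ Finset.range t, γ₀ ^ s • Finsupp.single q₀ 1 := ⟨_, rfl⟩
  -- the module identity behind the relator
  have hmod : aq • (-S) - κ • (-S) + (κ * ρ) • m₀ = 0 := by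
    have e1 : κ • q₀ = cq⁻¹ • pt₁ := by rw [hq₀, ← mul_smul, mul_inv_cancel_left]
    have e2 : (κ * γ₀ ^ t) • q₀ = cq⁻¹ • pt := by
      rw [hq₀, hpt₁, ← mul_smul, ← mul_smul, hγ, conj_pow, hu]
      congr 1
      group
    have tele : (∑ s ∈ Finset.range t, γ₀ ^ s • Finsupp.single q₀ (1 : ZMod (Nat.card (P ⧸ (N : Subgroup P))))) -
        γ₀ • (∑ s ∈ Finset.range t, γ₀ ^ s • Finsupp.single q₀ (1 : ZMod (Nat.card (P ⧸ (N : Subgroup P))))) =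
        Finsupp.single q₀ 1 - γ₀ ^ t • Finsupp.single q₀ 1 :=
      sum_smul_pow_sub_smul γ₀ _ t
    have key : κ • S - κ • (γ₀ • S) =
        Finsupp.single (cq⁻¹ • pt₁) 1 - Finsupp.single (cq⁻¹ • pt) 1 := by
      rw [← smul_sub κ S (γ₀ • S), hSdef, tele, smul_sub, ← mul_smul,
        Finsupp.comapSMul_single, Finsupp.comapSMul_single, e1, e2]
    have key' : κ • S - κ • (γ₀ • S) - Finsupp.single (cq⁻¹ • pt₁) 1 + Finsupp.single (cq⁻¹ • pt) 1 = 0 := by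
      rw [key]; abel
    have h1 : aq = κ * γ₀ := by rw [hγ₀, mul_inv_cancel_left]
    rw [h1, hκρ, hm₀, mul_smul, smul_sub, Finsupp.comapSMul_single, Finsupp.comapSMul_single]
    simp only [smul_neg]
    convert key' using 1
    abel
  -- the permutation module and the lift `φ₀`
  let τ : (P ⧸ (N : Subgroup P)) →*
      MulAut (Multiplicative (((P ⧸ (N : Subgroup P)) ⧸ C) →₀ ZMod (Nat.card (P ⧸ (N : Subgroup P))))) :=
    (MulAutMultiplicative _).symm.toMonoidHom.comp (DistribMulAction.toAddAut _ _)
  have hτ : ∀ (q : P ⧸ (N : Subgroup P))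
      (m : Multiplicative (((P ⧸ (N : Subgroup P)) ⧸ C) →₀ ZMod (Nat.card (P ⧸ (N : Subgroup P)))))
      (a : (P ⧸ (N : Subgroup P)) ⧸ C), toAdd (τ q m) a = toAdd m (q⁻¹ • a) := fun q m a => by
    change (q • toAdd m) a = _
    exact Finsupp.comapSMul_apply q _ a
  let W := Multiplicative (((P ⧸ (N : Subgroup P)) ⧸ C) →₀ ZMod (Nat.card (P ⧸ (N : Subgroup P)))) ⋊[τ]
    (P ⧸ (N : Subgroup P))
  let f : puncturedSurfaceGen (g' + 1) 1 → W := fun s =>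
    match s with
    | Sum.inl (i, false) => SemidirectProduct.inr (θ (PuncturedSurfaceGroup.a i))
    | Sum.inl (i, true) =>
        if i = 0 then ⟨ofAdd (-S), bq⟩ else SemidirectProduct.inr (θ (PuncturedSurfaceGroup.b i))
    | Sum.inr _ => ⟨ofAdd m₀, cq⟩
  have hfa : ∀ i, f (Sum.inl (i, false)) = SemidirectProduct.inr (θ (PuncturedSurfaceGroup.a i)) :=
    fun i => rfl
  have hfb0 : f (Sum.inl (0, true)) = ⟨ofAdd (-S), bq⟩ := by simp [f]
  have hfbs : ∀ i : Fin g', f (Sum.inl (i.succ, true)) =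
      SemidirectProduct.inr (θ (PuncturedSurfaceGroup.b i.succ)) := fun i => by
    simp [f, Fin.succ_ne_zero]
  have hfc : ∀ j, f (Sum.inr j) = ⟨ofAdd m₀, cq⟩ := fun j => rfl
  have hrelW : ∀ v ∈ ({PuncturedSurfaceGroup.relator (g' + 1) 1} :
      Set (FreeGroup (puncturedSurfaceGen (g' + 1) 1))), FreeGroup.lift f v = 1 := by
    intro v hv
    rw [Set.mem_singleton_iff] at hv
    subst hv
    rw [PuncturedSurfaceGroup.lift_relator, List.finRange_succ, List.map_cons, List.prod_cons,
      List.map_map]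
    have htail : ((List.finRange g').map ((fun i : Fin (g' + 1) =>
        f (Sum.inl (i, false)) * f (Sum.inl (i, true)) * (f (Sum.inl (i, false)))⁻¹ *
          (f (Sum.inl (i, true)))⁻¹) ∘ Fin.succ)).prod = SemidirectProduct.inr ρ := by
      rw [hρ, ← prod_commutator_inr τ]
      congr 1
    have hhead : ((List.finRange 1).map fun j => f (Sum.inr j)).prod = ⟨ofAdd m₀, cq⟩ := by
      simp [List.finRange_succ, hfc]
    rw [htail, hhead, hfa 0, hfb0, ← haq]
    obtain ⟨hTr, hTl⟩ := wreath_commutator_inr τ hτ aq bq (-S)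
    rw [← hκ] at hTr hTl
    apply SemidirectProduct.ext
    · -- translation component
      rw [SemidirectProduct.mul_left, SemidirectProduct.mul_left, SemidirectProduct.left_inr, map_one,
        mul_one, SemidirectProduct.mul_right, hTr, SemidirectProduct.right_inr, SemidirectProduct.one_left]
      apply toAdd.injective
      rw [toAdd_mul, toAdd_one]
      ext q
      rw [Finsupp.add_apply, hTl q, hτ, Finsupp.zero_apply]
      change (-S) (aq⁻¹ • q) - (-S) (κ⁻¹ • q) + m₀ ((κ * ρ)⁻¹ • q) = 0
      have hq := DFunLike.congr_fun hmod q
      simp only [Finsupp.add_apply, Finsupp.sub_apply, Finsupp.comapSMul_apply, Finsupp.coe_zero,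
        Pi.zero_apply] at hq
      exact hq
    · -- `Q`-component
      rw [SemidirectProduct.mul_right, SemidirectProduct.mul_right, hTr, SemidirectProduct.right_inr,
        SemidirectProduct.one_right]
      exact hrel
  let φ₀ : PuncturedSurfaceGroup (g' + 1) 1 →* W := PresentedGroup.toGroup hrelW
  have hφ₀of : ∀ s, φ₀ (PresentedGroup.of s) = f s := fun s => PresentedGroup.toGroup.of hrelW
  have hφ₀right : ∀ γ', (φ₀ γ').right = QuotientGroup.mk (ι γ') := by
    intro γ'
    suffices h : SemidirectProduct.rightHom.comp φ₀ = θ from DFunLike.congr_fun h γ'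
    refine PresentedGroup.ext fun s => ?_
    rw [MonoidHom.comp_apply, hφ₀of]
    rcases s with ⟨i, _ | _⟩ | j
    · rw [hfa i, SemidirectProduct.rightHom_inr]; rfl
    · by_cases hi0 : i = 0
      · subst hi0; rw [hfb0, hbq]; rfl
      · obtain ⟨i', rfl⟩ := Fin.exists_succ_eq.mpr hi0
        rw [hfbs i', SemidirectProduct.rightHom_inr]; rfl
    · have hj0 : j = 0 := Fin.eq_zero j
      subst hj0
      rw [hfc 0, hcq]; rfl
  have hφ₀c : (φ₀ (PuncturedSurfaceGroup.c 0)).left = ofAdd m₀ := by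
    rw [PuncturedSurfaceGroup.c, hφ₀of, hfc 0]
  -- the hypotheses of the engine on `m₀`
  have hcq' : (QuotientGroup.mk (ι (PuncturedSurfaceGroup.c (0 : Fin 1))) : P ⧸ (N : Subgroup P)) = cq := by
    rw [hcq]; rfl
  have hxq' : (QuotientGroup.mk x : P ⧸ (N : Subgroup P)) = xq := by rw [hxq]; rfl
  have h1 : m₀ pt = 1 := by
    rw [hm₀, Finsupp.sub_apply, Finsupp.single_eq_same, Finsupp.single_eq_of_ne hpt₁ne.symm, sub_zero]
  have h0 : ∀ i : ℤ, m₀ ((cq ^ i * xq⁻¹) • pt) = 0 := by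
    intro i
    have hne1 : (cq ^ i * xq⁻¹) • pt ≠ pt := by
      intro h
      conv_rhs at h => rw [← one_smul (P ⧸ (N : Subgroup P)) pt]
      rw [hpt_eq, mul_one, mul_inv_rev, inv_inv] at h
      apply hxC
      have := C.mul_mem h (hC ▸ Subgroup.zpow_mem _ (Subgroup.mem_zpowers cq) i : cq ^ i ∈ C)
      rwa [inv_mul_cancel_right] at this
    have hne2 : (cq ^ i * xq⁻¹) • pt ≠ pt₁ := fun h => htB (h ▸ hBmem i)
    rw [hm₀, Finsupp.sub_apply, Finsupp.single_eq_of_ne hne1, Finsupp.single_eq_of_ne hne2, sub_zero]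
  rw [← hcq'] at hcpt h0
  rw [← hxq'] at h0
  exact IsProSigmaCompletion.mem_of_wreathLift hι (PuncturedSurfaceGroup.c 0) N τ hτ hcpt h1 h0 φ₀
    hφ₀right hφ₀c hyI hyJ

/-- **The once-punctured clause of `ProSigmaCuspInertiaMalnormal`, closed form** (universe-polymorphic in
`P`): for every nonempty set of primes `Σ`, every hyperbolic `(g, 1)`, every pro-`Σ` completion
`ι : Γ_{g,1} → P` and every `x` outside the closed cusp inertia `I = closure ι⟨c₁⟩`, `I ∩ x I x⁻¹ = 1`.
This is verbatim the hypothesis `hone` of the assembled named fact (abc-iut-w5-d016's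
`proSigmaCuspInertiaMalnormal_of_onePunctured`). [cite: MochizukiSemiAnbd2006, Ex. 2.10 p.31] -/
theorem proSigmaCuspInertiaMalnormal_onePunctured :
    ∀ (Sigma : Set ℕ), Sigma.Nonempty → (∀ p ∈ Sigma, p.Prime) →
      ∀ (g : ℕ), PuncturedSurfaceGroup.IsHyperbolicType g 1 →
        ∀ (P : Type*) [Group P] [TopologicalSpace P] [IsTopologicalGroup P] [CompactSpace P]
          [T2Space P] [TotallyDisconnectedSpace P] (ι : PuncturedSurfaceGroup g 1 →* P),
          IsProSigmaCompletion Sigma ι →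
            ∀ x : P, x ∉ ((PuncturedSurfaceGroup.cuspInertia (g := g) (0 : Fin 1)).map ι).topologicalClosure →
              ((PuncturedSurfaceGroup.cuspInertia (g := g) (0 : Fin 1)).map ι).topologicalClosure ⊓
                ConjAct.toConjAct x •
                  ((PuncturedSurfaceGroup.cuspInertia (g := g) (0 : Fin 1)).map ι).topologicalClosure
                = ⊥ :=
  fun _ hne hprime _ h _ _ _ _ _ _ _ ι hι x hx =>
    cuspInertia_closure_inf_conj_eq_bot_of_one hne hprime h ι hι 0 0 x (Or.inr hx)

end Literature.AnabelianGeometry.SemiGraphs.SemiGraphOfAnabelioids
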